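import Literature.AlgebraicGeometry.Resolution.ResolutionOfSingularities
import Literature.AlgebraicGeometry.Resolution.FiniteSubextensionDescent
import Literature.AlgebraicGeometry.Resolution.AlterationsDescentStage
import Literature.AlgebraicGeometry.Resolution.PrincipalizationToResolution
import Literature.AlgebraicGeometry.Morphisms.RefinedValuativeCriterionDense
import Mathlib.AlgebraicGeometry.Morphisms.FlatDescent
import Mathlib.AlgebraicGeometry.Morphisms.ClosedImmersion
import Mathlib.AlgebraicGeometry.Morphisms.Flat
import Mathlib.AlgebraicGeometry.Morphisms.Proper
import Mathlib.AlgebraicGeometry.Noetherian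
import Mathlib.FieldTheory.PurelyInseparable.Basic
import HarnessLib

/-!
# `WeightedInvariant.DescentPerfectToAll`, line `root-of-a-constant`: descent of the properties

Route `ResolutionOfSingularities/WeightedInvariant`, crux `DescentPerfectToAll`
(stmt-ResolutionOfSingularities-0549), stub `stub_descendResolutionProps` of the lead's skeleton
`work/DescentPerfectToAll.lean`, PROVED here (statement verbatim from the ledger registration).

**Statement.** `Ω / k` purely inseparable, `K ⊆ Ω` a subextension, `f : X → Spec k` locally of
finite type and quasi-compact, `ι_W : W ↪ X_Ω = X ×_k Spec Ω` a surjective closed immersion with `W`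
reduced (`W = (X_Ω)_red`), `π : Y → W` a resolution of singularities, and `g_K : Y_K → X_K` proper
with `Y = Y_K ×_{X_K} X_Ω` along the transition map `t : X_Ω → X_K` (a cartesian square
`(e, π ≫ ι_W, g_K, t)`). Then `Z = (X_K)_red` (a reduced closed subscheme of `X_K` with full
support) admits a resolution of singularities, namely the factorisation `π_K : Y_K → Z` of `g_K`.

**Proof** (EGA IV₂ 6.5.1 / Matsumura 23.7 (i) for regularity; EGA IV₂ 2.7.1, Stacks 02L6, 04DE,
01S4 for the descent steps; all folklore, proved in Mathlib's vocabulary).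
* `t` is a base change of `Spec Ω → Spec K`, hence affine, flat, surjective, universally closed
  (`FiniteSubextensionDescent`), and universally injective since `Ω / K` is purely inseparable
  (`universallyInjective_SpecMap_of_isPurelyInseparable`: `K`-embeddings of `Ω` into a field are
  unique); `e` is a base change of `t`.
* `Y_K` is REGULAR: it is locally Noetherian (of finite type over `X_K`, itself of finite type over
  `K`) and `e : Y → Y_K` is flat and surjective from the regular `Y`
  (`DeJong1996.Stage.isRegular_of_flat_surjective`, i.e.
  `IsRegularLocalRing.of_flat_of_isLocalHom`).
  Hence `Y_K` is reduced and `g_K` factors as `π_K ≫ ι_Z` through `Z = (X_K)_red`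
  (`nilradical_le_ker`); `π_K` is PROPER by cancellation of the closed immersion `ι_Z`.
* BIRATIONAL (`isBirational_of_isPullback_nilImmersion`): put `Z_Ω = Z ×_{X_K} X_Ω ↪ X_Ω` (a
  surjective closed immersion, so `ι_W` factors as `r ≫ (Z_Ω ↪ X_Ω)` with `r : W ↪ Z_Ω` a surjective
  closed immersion) and `p₁ : Z_Ω → Z` (a base change of `t`). The square `(π ≫ r, e, p₁, π_K)` is
  cartesian. The composite `W → Z_Ω → Z` is a continuous closed bijection, so the dense open
  `U₀ ⊆ W` over which `π` is an isomorphism is the preimage of an open `U ⊆ Z`, dense (the image of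
  `U₀`), with `π_K⁻¹ U = e(π⁻¹ U₀)` dense. Over `p₁⁻¹ U` the base change `π ≫ r` of `π_K` restricts
  to (isomorphism) ≫ (surjective closed immersion); by fpqc descent of universal injectivity and
  surjectivity (Mathlib `FlatDescent`) `π_K ∣ U` is a closed continuous bijection onto `U`, hence
  AFFINE (Stacks 04DE, Mathlib `isAffineHom_of_isInducing`), hence a closed immersion — closed
  immersions descend along flat surjective affine morphisms AMONG AFFINE MORPHISMS
  (`isClosedImmersion_of_isPullback_of_isAffineHom`: the ring map `Γ(U) → Γ(h⁻¹ U)` is surjective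
  because it becomes so after the faithfully flat base change `Γ(U) → Γ(q⁻¹ U)`, Mathlib
  `RingHom.FaithfullyFlat.codescendsAlong_surjective`; the general Stacks 02L6 needs descent of
  affineness, a Mathlib TODO, and is not used) — hence an isomorphism onto the reduced `U`
  (`isIso_morphismRestrict_of_isPullback`).

## Sources

* A. Grothendieck, J. Dieudonné, EGA IV₂ (1965), Prop. 6.5.1 (i), Prop. 2.7.1. [EGAIV2]
* H. Matsumura, *Commutative Ring Theory* (1987), Thm. 23.7 (i). [Matsumura1987]
* The Stacks Project, Tags 02L6, 04DE, 01S4. [StacksProject]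
-/

set_option linter.dupNamespace false -- mandated namespace of this single-conjunct summit

noncomputable section

open CategoryTheory CategoryTheory.Limits AlgebraicGeometry TopologicalSpace
open Literature.AlgebraicGeometry.Resolution Literature.AlgebraicGeometry.Morphisms

namespace Summit.ResolutionOfSingularities.ResolutionOfSingularities.Theorems

universe u

/-! ## fpqc descent tools -/

/-- **Restriction of a cartesian square over an open of the base corner.** If
`(h', g, q, h)` is cartesian (`h' ≫ q = g ≫ h`, `V' = U' ×_U V`) and `W ⊆ U` is open, then
`(h' ∣ q⁻¹W, g', q ∣ W, h ∣ W)` is cartesian for the induced `g' : h'⁻¹ q⁻¹ W → h⁻¹ W`.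
[folklore] -/
theorem exists_isPullback_morphismRestrict {U U' V V' : Scheme.{u}} {h : V ⟶ U} {q : U' ⟶ U}
    {h' : V' ⟶ U'} {g : V' ⟶ V} (sq : IsPullback h' g q h) (W : U.Opens) :
    ∃ g' : (↑(h' ⁻¹ᵁ (q ⁻¹ᵁ W)) : Scheme.{u}) ⟶ ↑(h ⁻¹ᵁ W),
      IsPullback (h' ∣_ (q ⁻¹ᵁ W)) g' (q ∣_ W) (h ∣_ W) := by
  have outer := (isPullback_morphismRestrict h' (q ⁻¹ᵁ W)).flip.paste_horiz sq.flip
  rw [← morphismRestrict_ι] at outer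
  exact ⟨_, (IsPullback.of_right' outer (isPullback_morphismRestrict h W).flip).flip⟩

/-- **Surjectivity of the ring map descends along a faithfully flat base change (affine case).**
For a cartesian square `(h', g, q, h)` of affine schemes with `q` flat and surjective, if
`Γ(h')` is surjective then so is `Γ(h)` (`Γ(V') = Γ(V) ⊗_{Γ(U)} Γ(U')` and `Γ(U) → Γ(U')` is
faithfully flat). [folklore] -/
theorem surjective_appTop_of_isPullback {U U' V V' : Scheme.{u}} [IsAffine U] [IsAffine U']
    [IsAffine V] {h : V ⟶ U} {q : U' ⟶ U} {h' : V' ⟶ U'} {g : V' ⟶ V}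
    (sq : IsPullback h' g q h) [Flat q] [Surjective q]
    (hh' : Function.Surjective h'.appTop) : Function.Surjective h.appTop := by
  haveI : IsAffine V' := IsAffine.of_isPullback sq
  have H := isPushout_appTop_of_isPullback sq
  have hq : q.appTop.hom.FaithfullyFlat :=
    (Flat.flat_and_surjective_iff_faithfullyFlat_of_isAffine q).mp ⟨‹_›, ‹_›⟩
  algebraize [q.appTop.hom, h.appTop.hom, h'.appTop.hom, g.appTop.hom,
    h'.appTop.hom.comp q.appTop.hom]
  haveI : IsScalarTower Γ(U, ⊤) Γ(V, ⊤) Γ(V', ⊤) := .of_algebraMap_eq fun x => by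
    have hx := congr(($(H.w)).hom x)
    simp only [CommRingCat.hom_comp, RingHom.coe_comp, Function.comp_apply] at hx
    exact hx
  have hP : Algebra.IsPushout Γ(U, ⊤) Γ(U', ⊤) Γ(V, ⊤) Γ(V', ⊤) :=
    CommRingCat.isPushout_iff_isPushout.mp H
  haveI := hP.symm
  have hq' : (algebraMap Γ(U, ⊤) Γ(U', ⊤)).FaithfullyFlat := hq
  have hh'' : Function.Surjective (algebraMap Γ(U', ⊤) Γ(V', ⊤)) := hh'
  exact RingHom.FaithfullyFlat.codescendsAlong_surjective hq' hh''

/-- **Closed immersions descend along flat surjective affine morphisms, among affine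
morphisms** (the case of Stacks 02L6 with affineness of the descended morphism given): for a
cartesian square `(h', g, q, h)` with `q` flat, surjective and affine and `h` affine, if the base
change `h'` of `h` is a closed immersion then so is `h`. [cite: StacksProject, Tag 02L6] -/
theorem isClosedImmersion_of_isPullback_of_isAffineHom {U U' V V' : Scheme.{u}} {h : V ⟶ U}
    {q : U' ⟶ U} {h' : V' ⟶ U'} {g : V' ⟶ V} (sq : IsPullback h' g q h) [Flat q] [Surjective q]
    [IsAffineHom q] [IsAffineHom h] [IsClosedImmersion h'] : IsClosedImmersion h := by
  rw [HasAffineProperty.iff_of_iSup_eq_top (P := @IsClosedImmersion) (fun W : U.affineOpens => W)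
    (iSup_affineOpens_eq_top U)]
  intro W
  haveI : IsAffine (W : U.Opens) := W.2
  haveI : IsAffine (q ⁻¹ᵁ (W : U.Opens)) := W.2.preimage q
  haveI : IsAffine (h ⁻¹ᵁ (W : U.Opens)) := W.2.preimage h
  haveI : Surjective (q ∣_ (W : U.Opens)) := IsZariskiLocalAtTarget.restrict ‹_› _
  refine ⟨inferInstance, ?_⟩
  obtain ⟨g', sqW⟩ := exists_isPullback_morphismRestrict sq (W : U.Opens)
  refine surjective_appTop_of_isPullback sqW ?_
  exact ((HasAffineProperty.iff_of_isAffine (P := @IsClosedImmersion)).mp inferInstance).2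

/-- **Isomorphism over an open by descent.** Let `(π', e, p, πK)` be cartesian
(`Y = Z' ×_Z Y_K`, `π' : Y → Z'`, `πK : Y_K → Z`) with `p : Z' → Z` flat, surjective and
affine, `πK` universally closed and `Z` reduced. If `π'` restricts over `p⁻¹ U` to a surjective
closed immersion, then `πK` restricts over `U` to an isomorphism: universal injectivity and
surjectivity descend along the fpqc cover `p ∣ U`, so `πK ∣ U` is a closed continuous bijection,
hence affine (Stacks 04DE), hence a closed immersion
(`isClosedImmersion_of_isPullback_of_isAffineHom`),
hence an isomorphism onto the reduced `U`. [folklore] -/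
theorem isIso_morphismRestrict_of_isPullback {Y Z' YK Z : Scheme.{u}} {π' : Y ⟶ Z'} {e : Y ⟶ YK}
    {p : Z' ⟶ Z} {πK : YK ⟶ Z} (sq : IsPullback π' e p πK) [Flat p] [Surjective p]
    [IsAffineHom p] [UniversallyClosed πK] [IsReduced Z] (U : Z.Opens)
    [IsClosedImmersion (π' ∣_ (p ⁻¹ᵁ U))] [Surjective (π' ∣_ (p ⁻¹ᵁ U))] : IsIso (πK ∣_ U) := by
  obtain ⟨g', sqU⟩ := exists_isPullback_morphismRestrict sq U
  haveI : Surjective (p ∣_ U) := IsZariskiLocalAtTarget.restrict ‹_› U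
  haveI : IsAffineHom (p ∣_ U) := IsZariskiLocalAtTarget.restrict ‹_› U
  have hQ : (@Surjective ⊓ @Flat ⊓ @QuasiCompact : MorphismProperty Scheme.{u}) (p ∣_ U) :=
    ⟨⟨‹_›, inferInstance⟩, inferInstance⟩
  haveI : UniversallyInjective (πK ∣_ U) :=
    MorphismProperty.of_isPullback_of_descendsAlong (P := @UniversallyInjective) sqU hQ
      inferInstance
  haveI : Surjective (πK ∣_ U) :=
    MorphismProperty.of_isPullback_of_descendsAlong (P := @Surjective) sqU hQ inferInstance
  have hce : Topology.IsClosedEmbedding (πK ∣_ U) :=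
    .of_continuous_injective_isClosedMap (πK ∣_ U).continuous (πK ∣_ U).injective
      (πK ∣_ U).isClosedMap
  haveI : IsAffineHom (πK ∣_ U) := isAffineHom_of_isInducing _ hce.isInducing hce.isClosed_range
  haveI : IsClosedImmersion (πK ∣_ U) := isClosedImmersion_of_isPullback_of_isAffineHom sqU
  exact isIso_of_isClosedImmersion_of_surjective _

/-- **`Spec Ω → Spec K` is universally injective (radicial) for `Ω / K` purely inseparable**:
two morphisms `Spec L → Spec Ω` (`L` a field) that agree over `Spec K` are equal, because a
purely inseparable extension has at most one `K`-embedding into any reduced ring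
(Stacks 01S4 (2)). [cite: StacksProject, Tag 01S4] -/
theorem universallyInjective_SpecMap_of_isPurelyInseparable (K Ω : Type u) [Field K] [Field Ω]
    [Algebra K Ω] [IsPurelyInseparable K Ω] :
    UniversallyInjective (Spec.map (CommRingCat.ofHom (algebraMap K Ω))) := by
  refine ((tfae_universallyInjective (Spec.map (CommRingCat.ofHom (algebraMap K Ω)))).out 0 1).mpr
    ?_
  intro L _ g₁ g₂ hg
  obtain ⟨φ₁, rfl⟩ := Spec.map_surjective g₁
  obtain ⟨φ₂, rfl⟩ := Spec.map_surjective g₂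
  dsimp only at hg
  rw [← Spec.map_comp, ← Spec.map_comp] at hg
  have h := Spec.map_injective hg
  have h' : φ₁.hom.comp (algebraMap K Ω) = φ₂.hom.comp (algebraMap K Ω) := congr(($h).hom)
  have hφ : φ₁ = φ₂ :=
    CommRingCat.hom_ext (IsPurelyInseparable.injective_comp_algebraMap K Ω L h')
  rw [hφ]

/-! ## The descent of the resolution -/

/-- **Birationality through a radicial nil-immersion base change.** Let `(π ≫ r, e, p, π_K)` be a
cartesian square (`Y = Z' ×_Z Y_K`) where `p : Z' → Z` is flat, surjective, affine, universally
injective and universally closed, `r : W ↪ Z'` is a surjective closed immersion, `π_K` is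
universally closed and `Z` is reduced. If `π : Y → W` is birational then so is `π_K : Y_K → Z`: the
continuous closed bijection `W → Z' → Z` carries the dense open `U₀ ⊆ W` over which `π` is an
isomorphism to a dense open `U ⊆ Z` with dense preimage `π_K⁻¹ U = e(π⁻¹ U₀)`, and over `p⁻¹ U` the
base change `π ≫ r` of `π_K` is a surjective closed immersion, so `π_K ∣ U` is an isomorphism by
`isIso_morphismRestrict_of_isPullback`. [folklore] -/
theorem isBirational_of_isPullback_nilImmersion {Y W Z' YK Z : Scheme.{u}} {π : Y ⟶ W}
    {r : W ⟶ Z'} {e : Y ⟶ YK} {p : Z' ⟶ Z} {πK : YK ⟶ Z} (sq : IsPullback (π ≫ r) e p πK)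
    [Flat p] [Surjective p] [IsAffineHom p] [UniversallyInjective p] [UniversallyClosed p]
    [IsClosedImmersion r] [Surjective r] [UniversallyClosed πK] [IsReduced Z]
    (hπ : IsBirational π) : IsBirational πK := by
  obtain ⟨U₀, hU₀, hU₀', hiso⟩ := hπ
  haveI : Surjective e := MorphismProperty.of_isPullback sq ‹Surjective p›
  -- `ψ = r ≫ p : W → Z` is a continuous closed bijection
  haveI : UniversallyInjective (r ≫ p) :=
    MorphismProperty.comp_mem _ r p inferInstance inferInstance
  have hψinj : Function.Injective (r ≫ p) := (r ≫ p).injective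
  have hψsurj : Function.Surjective (r ≫ p) := (r ≫ p).surjective
  have hψcl : IsClosedMap (r ≫ p) := (r ≫ p).isClosedMap
  let U : Z.Opens :=
    ⟨((r ≫ p) '' (U₀ : Set W)ᶜ)ᶜ, (hψcl _ U₀.isOpen.isClosed_compl).isOpen_compl⟩
  have hU : (r ≫ p) ⁻¹ᵁ U = U₀ := by
    ext w
    change (r ≫ p) w ∈ ((r ≫ p) '' (U₀ : Set W)ᶜ)ᶜ ↔ w ∈ (U₀ : Set W)
    rw [Set.mem_compl_iff, hψinj.mem_set_image, Set.notMem_compl_iff]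
  have hUeq : (U : Set Z) = (r ≫ p) '' (U₀ : Set W) := by
    change ((r ≫ p) '' (U₀ : Set W)ᶜ)ᶜ = _
    rw [Set.image_compl_eq ⟨hψinj, hψsurj⟩, compl_compl]
  refine ⟨U, ?_, ?_, ?_⟩
  · rw [hUeq]
    exact hψsurj.denseRange.dense_image (r ≫ p).continuous hU₀
  · have h1 : e ⁻¹ᵁ (πK ⁻¹ᵁ U) = π ⁻¹ᵁ U₀ := by
      rw [← Scheme.Hom.comp_preimage, ← sq.w, Category.assoc, Scheme.Hom.comp_preimage, hU]
    have h2 : ((πK ⁻¹ᵁ U : YK.Opens) : Set YK) = e '' ((π ⁻¹ᵁ U₀ : Y.Opens) : Set Y) := by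
      rw [← h1]
      exact (Set.image_preimage_eq _ e.surjective).symm
    rw [h2]
    exact e.surjective.denseRange.dense_image e.continuous hU₀'
  · have hV : r ⁻¹ᵁ (p ⁻¹ᵁ U) = U₀ := by rw [← Scheme.Hom.comp_preimage, hU]
    haveI : IsIso (π ∣_ (r ⁻¹ᵁ (p ⁻¹ᵁ U))) := by
      rw [hV]
      exact hiso
    haveI : Surjective (r ∣_ (p ⁻¹ᵁ U)) := IsZariskiLocalAtTarget.restrict ‹_› _
    have h₁ : IsClosedImmersion ((π ∣_ (r ⁻¹ᵁ (p ⁻¹ᵁ U))) ≫ (r ∣_ (p ⁻¹ᵁ U))) := by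
      rw [MorphismProperty.cancel_left_of_respectsIso @IsClosedImmersion]
      infer_instance
    have h₂ : Surjective ((π ∣_ (r ⁻¹ᵁ (p ⁻¹ᵁ U))) ≫ (r ∣_ (p ⁻¹ᵁ U))) := inferInstance
    haveI : IsClosedImmersion ((π ≫ r) ∣_ (p ⁻¹ᵁ U)) := by
      rw [morphismRestrict_comp]
      exact h₁
    haveI : Surjective ((π ≫ r) ∣_ (p ⁻¹ᵁ U)) := by
      rw [morphismRestrict_comp]
      exact h₂
    exact isIso_morphismRestrict_of_isPullback sq U

/-- **The reduction of `X_K` has a resolution.** Let `t : X_Ω → X_K` be flat, surjective, affine,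
universally injective and universally closed (a base change of `Spec Ω → Spec K`, `Ω / K` purely
inseparable) with `X_K` locally Noetherian, `ι_W : W ↪ X_Ω` a surjective closed immersion from a
reduced scheme, `π : Y → W` a resolution, `g_K : Y_K → X_K` proper and `(e, π ≫ ι_W, g_K, t)`
cartesian. Then `(X_K)_red` has a resolution: `Y_K` is regular (flat descent along the flat
surjective `e`, Matsumura 23.7 (i)) hence reduced, so `g_K` factors through `π_K : Y_K → (X_K)_red`,
proper by cancellation and birational by `isBirational_of_isPullback_nilImmersion` applied with
`Z_Ω = (X_K)_red ×_{X_K} X_Ω` and the factorisation `r : W ↪ Z_Ω` of `ι_W`.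
[cite: EGAIV2, Prop. 6.5.1 (i)] -/
theorem hasResolution_nilradical_of_isPullback {XK XΩ W Y YK : Scheme.{u}} {t : XΩ ⟶ XK} [Flat t]
    [Surjective t] [IsAffineHom t] [UniversallyInjective t] [UniversallyClosed t]
    [IsLocallyNoetherian XK] {ιW : W ⟶ XΩ} [IsClosedImmersion ιW] [Surjective ιW] [IsReduced W]
    {π : Y ⟶ W} (hπ : IsResolution π) {gK : YK ⟶ XK} [IsProper gK] {e : Y ⟶ YK}
    (hsq : IsPullback e (π ≫ ιW) gK t) : Scheme.HasResolution XK.nilradical.subscheme := by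
  haveI := hπ.isProper
  -- `e` is flat and surjective, `Y_K` is locally Noetherian, regular and reduced
  haveI : Flat e := MorphismProperty.of_isPullback hsq.flip ‹Flat t›
  haveI : Surjective e := MorphismProperty.of_isPullback hsq.flip ‹Surjective t›
  haveI : IsLocallyNoetherian YK := LocallyOfFiniteType.isLocallyNoetherian gK
  have hreg : Scheme.IsRegular YK := DeJong1996.Stage.isRegular_of_flat_surjective e hπ.isRegular
  haveI : IsReduced YK := hreg.isReduced
  -- the factorisation `π_K : Y_K → Z = (X_K)_red` of `g_K`
  have hker : XK.nilradical.subschemeι.ker ≤ gK.ker := by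
    rw [Scheme.IdealSheafData.ker_subschemeι]
    exact nilradical_le_ker gK
  obtain ⟨πK, hfac⟩ : ∃ πK : YK ⟶ XK.nilradical.subscheme, πK ≫ XK.nilradical.subschemeι = gK :=
    ⟨IsClosedImmersion.lift _ gK hker, IsClosedImmersion.lift_fac _ _ _⟩
  haveI : IsProper (πK ≫ XK.nilradical.subschemeι) := by rw [hfac]; infer_instance
  haveI : IsProper πK := IsProper.of_comp πK XK.nilradical.subschemeι
  -- `Z_Ω = Z ×_{X_K} X_Ω`, its projections `p₁`, `p₂`, and the factorisation `r : W ↪ Z_Ω` of `ι_W`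
  haveI : IsAffineHom (pullback.fst XK.nilradical.subschemeι t) :=
    MorphismProperty.pullback_fst _ _ ‹_›
  haveI : UniversallyInjective (pullback.fst XK.nilradical.subschemeι t) :=
    MorphismProperty.pullback_fst _ _ ‹_›
  have hker₂ : (pullback.snd XK.nilradical.subschemeι t).ker ≤ ιW.ker := by
    refine le_trans ?_ (nilradical_le_ker ιW)
    rw [← Scheme.IdealSheafData.vanishingIdeal_top (X := XΩ),
      ← Scheme.IdealSheafData.le_support_iff_le_vanishingIdeal]
    intro x _
    show x ∈ ((pullback.snd XK.nilradical.subschemeι t).ker.support : Set XΩ)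
    rw [Scheme.Hom.support_ker, (pullback.snd XK.nilradical.subschemeι t).surjective.range_eq,
      closure_univ]
    trivial
  obtain ⟨r, hr⟩ : ∃ r : W ⟶ pullback XK.nilradical.subschemeι t,
      r ≫ pullback.snd XK.nilradical.subschemeι t = ιW :=
    ⟨IsClosedImmersion.lift _ ιW hker₂, IsClosedImmersion.lift_fac _ _ _⟩
  haveI : IsClosedImmersion (r ≫ pullback.snd XK.nilradical.subschemeι t) := by
    rw [hr]; infer_instance
  haveI : IsClosedImmersion r :=
    IsClosedImmersion.of_comp_isClosedImmersion r (pullback.snd XK.nilradical.subschemeι t)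
  haveI : Surjective r := ⟨fun z => by
    obtain ⟨w, hw⟩ := ιW.surjective (pullback.snd XK.nilradical.subschemeι t z)
    refine ⟨w, (pullback.snd XK.nilradical.subschemeι t).isClosedEmbedding.injective ?_⟩
    rw [← Scheme.Hom.comp_apply, hr, hw]⟩
  -- the cartesian square `(π ≫ r, e, p₁, π_K)`
  have hcomm : (π ≫ r) ≫ pullback.fst XK.nilradical.subschemeι t = e ≫ πK := by
    rw [← cancel_mono XK.nilradical.subschemeι]
    simp only [Category.assoc]
    rw [pullback.condition, reassoc_of% hr, hfac]
    exact hsq.w.symm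
  have sqZ : IsPullback (π ≫ r) e (pullback.fst XK.nilradical.subschemeι t) πK := by
    refine IsPullback.of_right (h₁₂ := pullback.snd XK.nilradical.subschemeι t) (v₁₃ := t)
      (h₂₂ := XK.nilradical.subschemeι) ?_ hcomm (IsPullback.of_hasPullback _ t).flip
    rw [Category.assoc, hr, hfac]
    exact hsq.flip
  exact ⟨YK, πK, ‹_›, isBirational_of_isPullback_nilImmersion sqZ hπ.isBirational, hreg⟩

/-- STUB `stub_descendResolutionProps` (descent of the properties at a finite purely inseparable
level): with `Ω/k` purely inseparable, `W = (X ⊗_k Ω)_red`, a resolution `π : Y → W`, and a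
cartesian presentation `Y = Y_K ×_{X_K} X_Ω` of `π ≫ ι_W` over a subextension `K`, the reduction
`Z = (X ⊗_k K)_red` has a resolution (namely `Y_K → Z`: regular by faithfully flat descent, proper
by cancellation, birational because `X_Ω → X_K` is a universal homeomorphism and a surjective closed
immersion onto a reduced scheme is an isomorphism). [cite: EGAIV2, Prop. 6.5.1 (i)] -/
theorem stub_descendResolutionProps : ∀ (k Ω : Type) [Field k] [Field Ω] [Algebra k Ω] [IsPurelyInseparable k Ω] (K : IntermediateField k Ω) (X : Scheme.{0}) (f : X ⟶ Spec (.of k)), IsSeparated f → LocallyOfFiniteType f → QuasiCompact f → ∀ (W : Scheme.{0}) (ιW : W ⟶ pullback f (Spec.map (CommRingCat.ofHom (algebraMap k Ω)))), IsClosedImmersion ιW → Surjective ιW → IsReduced W → ∀ (Y : Scheme.{0}) (π : Y ⟶ W), IsResolution π → ∀ (YK : Scheme.{0}) (gK : YK ⟶ pullback f (Spec.map (CommRingCat.ofHom (algebraMap k K)))) (e : Y ⟶ YK) (t : pullback f (Spec.map (CommRingCat.ofHom (algebraMap k Ω))) ⟶ pullback f (Spec.map (CommRingCat.ofHom (algebraMap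 k K)))), IsProper gK → t ≫ pullback.fst f (Spec.map (CommRingCat.ofHom (algebraMap k K))) = pullback.fst f (Spec.map (CommRingCat.ofHom (algebraMap k Ω))) → t ≫ pullback.snd f (Spec.map (CommRingCat.ofHom (algebraMap k K))) = pullback.snd f (Spec.map (CommRingCat.ofHom (algebraMap k Ω))) ≫ Spec.map (CommRingCat.ofHom (algebraMap K Ω)) → IsPullback e (π ≫ ιW) gK t → ∃ (Z : Scheme.{0}) (ιZ : Z ⟶ pullback f (Spec.map (CommRingCat.ofHom (algebraMap k K)))), IsClosedImmersion ιZ ∧ Surjective ιZ ∧ IsReduced Z ∧ Scheme.HasResolution Z := by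
  intro k Ω _ _ _ _ K X f _ hlft hqc W ιW hcl hsurj hred Y π hπ YK gK e t hgK ht₁ ht₂ hsq
  haveI := hlft
  haveI := hqc
  haveI := hcl
  haveI := hsurj
  haveI := hred
  haveI := hgK
  -- `t` is the base change of `Spec Ω → Spec K` along `X_K → Spec K`
  have ht : IsPullback t (pullback.snd f (Spec.map (CommRingCat.ofHom (algebraMap k Ω))))
      (pullback.snd f (Spec.map (CommRingCat.ofHom (algebraMap k K))))
      (Spec.map (CommRingCat.ofHom (algebraMap K Ω))) := by
    refine IsPullback.of_right
      (h₁₂ := pullback.fst f (Spec.map (CommRingCat.ofHom (algebraMap k K)))) (v₁₃ := f)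
      (h₂₂ := Spec.map (CommRingCat.ofHom (algebraMap k K))) ?_ ht₂ (IsPullback.of_hasPullback _ _)
    rw [ht₁, specTo_comp_specOf]
    exact IsPullback.of_hasPullback _ _
  obtain ⟨h₁, h₂, h₃⟩ := isAffineHom_flat_surjective_of_isPullback ht
  haveI := h₁
  haveI := h₂
  haveI := h₃
  haveI : UniversallyClosed t := universallyClosed_of_isPullback (k := k) ht
  haveI : UniversallyInjective t := MorphismProperty.of_isPullback ht.flip
    (universallyInjective_SpecMap_of_isPurelyInseparable K Ω)
  haveI : IsLocallyNoetherian (pullback f (Spec.map (CommRingCat.ofHom (algebraMap k K)))) :=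
    LocallyOfFiniteType.isLocallyNoetherian
      (pullback.snd f (Spec.map (CommRingCat.ofHom (algebraMap k K))))
  exact ⟨_, (pullback f (Spec.map (CommRingCat.ofHom (algebraMap k K)))).nilradical.subschemeι,
    inferInstance, inferInstance, inferInstance, hasResolution_nilradical_of_isPullback hπ hsq⟩

end Summit.ResolutionOfSingularities.ResolutionOfSingularities.Theorems

end
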